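import Mathlib
import Summits.Ventures.HodgeRepro2.LiuOscillator
import Summits.Ventures.HodgeRepro2.T6B5Datum

/-!
# T6B5NonIsoHyp — Tier 6, sub-goal B5: the displayed clause (2) of Liu's Theorem 4.18 («mutually non-isomorphic»)

One display, a `def … : Prop` in the free parameter `𝓛 : LiuAlbaneseDatum K c χEF` (the representation-level
carriers of `T6B5Datum.lean`, whose `Rep` is the set of isomorphism classes of the adèlic oscillator representations
and whose `osc` sends a triple to its class): clause (2) of Liu 2021 Theorem 4.18 (p. 52 ll. 57–58), the summands
`ω(μ, ε, χ)` of the direct sum, indexed by the pairs `(ε, χ)` with `ε` μ-admissible, are mutually non-isomorphic.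
In the carried vocabulary: two admissible triples with the same `μ`, the same representative `e` of `ε` and the SAME
CLASS have the same `χ`. It is the printed input that makes the tree's reading of `d(μ, K)` — a sum over the DISTINCT
classes (t6-p6's `Liu.liuMultiplicity`, `Finset.image S.osc T`) — agree with the print's sum over the pairs `(ε, χ)`,
and the input of TIER4 §B5 Remark B5.9 («the m indices (ε_i, χ^{(j)}) are distinct») in kernel (`T6B5MFold.lean`).
Statement lane: definition and `#check` only. Journal page layer
`paper:liu2021-fourier-jacobi-cycles-arithmetic-relative-trace-formula` (Y. Liu, Cambridge J. Math. 9 (2021), no. 1,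
1–147; `p00NN` = journal page NN, `l.` = layer line), re-opened by t6-p8 (gen 12) in its own `lit read` copy.
README §8(d): uses an L-value-free non-vanishing device: NO.
-/

namespace Summit.Ventures.HodgeRepro2.T6.Hyp

open Summit.Ventures.HodgeRepro2.ShimuraData Summit.Ventures.HodgeRepro2.T6.B5Datum

universe u

variable {K : Type u} [Field K] [NumberField K] [NumberField.IsCMField K] {c : Liu.IdeleConjugation K}
  {χEF : Liu.QuadraticCharacter K c}

/-- [cite: Liu2021, Theorem 4.18 clause (2), Cambridge J. Math. 9 (2021) p. 52 ll. 57–58, layer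
paper:liu2021-fourier-jacobi-cycles-arithmetic-relative-trace-formula p0052 ll. 52–58 (the layer explodes the clause
across seven lines and displaces the subscript `F` of `A_F^∞` into «mutuF» / «ally»; reading order restored)]
«(2) The C[G(A∞
)]-modules
in
the
direct
sum in Theorem 4.18 are mutuF
ally non-isomorphic.» (layer ll. 52–58; = ‹(2) The C[G(A∞_F)]-modules in the direct sum in Theorem 4.18 are mutually
non-isomorphic.›; the direct sum is the one of the theorem's first sentence, p0052 ll. 37–47: «taken over all ε, χ such
that ε is μ-admissible», for the standing μ of Definition 4.16, p0052 ll. 6–8, a conjugate symplectic character of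
weight one) [display: over the representation-level datum `𝓛`, whose `Rep` is the set of isomorphism classes and
whose `osc t` is the class of `ω(μ, ε, χ)` for the concrete triple `t = (μ, e, χ)` (p2's `Liu.OscillatorTriple`, in
which `ε` is carried by a REPRESENTATIVE `e ∈ E^{-×}`): two admissible triples (weight one, `e` μ-admissible) with the
same `μ`, the same representative `e` — hence the same `ε` — and the same class have the same `χ` (distinct `χ` ⇒
distinct pairs `(ε, χ)` ⇒ non-isomorphic summands ⇒ distinct classes). WEAKER than print, marked: only the
`χ`-direction at a common representative `e` is carried — the `ε`-direction (`ε ≠ ε'` ⇒ non-isomorphic) is not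
stated, because the class `ε = e · N_{E/F}(E^×)` of a representative is not a carried object of the cell's triples;
this is exactly the clause Remark B5.9 consumes («the m indices (ε_i, χ^{(j)}) are distinct», one `ε_i` and `m`
characters). Consumed by `T6B5MFold.lean`] -/
def Liu2021_Thm4_18_2 (𝓛 : LiuAlbaneseDatum K c χEF) : Prop :=
  ∀ t t' : Liu.OscillatorTriple K c χEF,
    Liu.OscillatorTriple.IsAdmissible K t → Liu.OscillatorTriple.IsAdmissible K t' →
    t.μ = t'.μ → t.e = t'.e → 𝓛.osc t = 𝓛.osc t' → t.χ = t'.χ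

#check @Liu2021_Thm4_18_2

end Summit.Ventures.HodgeRepro2.T6.Hyp
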